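import Mathlib
import Literature.Probability.LatticeModels.TorusFourierProofs
import HarnessLib

/-!
# A Wiener-type `ℓ¹` bound for the discrete Fourier transform on `(ℤ/Lℤ)²` from first and second differences

Topic `Probability/LatticeModels`; companion of `TorusFourier` / `TorusFourierProofs` (`torusFourier`, `torusChar`, Plancherel
`torusFourier_plancherel_holds`).  The classical fact that the Fourier coefficients of a `C²` function on the `2`-torus are absolutely
summable with `Σ|f̂| ≲ ‖f‖_∞ + ‖D²f‖_∞` (Bernstein; `H^s ↪ A(𝕋^d)` for `s > d/2`), in the finite, uniform-in-`L` form used for lattice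
kernels: for `g : (ℤ/Lℤ)² → ℂ` with `‖g‖ ≤ S₀`, first differences `‖Δ_j g‖ ≤ D₁` and the mixed second difference `‖Δ₀Δ₁ g‖ ≤ D₂`,

  `L⁻² Σ_z ‖ĝ(z)‖ ≤ 6·√(S₀² + L²D₁²/8 + L⁴D₂²/256)`        (**`sum_norm_torusFourier_le_of_differences`**)

— so for samples `g(q) = K(2πq/L)` of a `C²` function (`D₁ ≤ ‖DK‖_∞·2π/L`, `D₂ ≤ ‖D²K‖_∞·(2π/L)²`) the `ℓ¹` norm of the lattice
position kernel `L⁻²ĝ` is bounded by `6(S₀ + π‖DK‖_∞/√2 + π²‖D²K‖_∞/4)`, uniformly in `L`.  Proof: Cauchy–Schwarz against the separable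
weight `W(z) = (1 + z̃₀²)(1 + z̃₁²)` (`z̃` the centred representative), `Σ_z W⁻¹ ≤ 36`, and `z̃_j² ‖ĝ(z)‖² ≤ (L²/16)‖(Δ_j g)^(z)‖²`
(shift theorem `(g(·+e))^ = χ(e)·ĝ` and `|χ_z(e_j) - 1| = 2|sin(π z̃_j/L)| ≥ 4|z̃_j|/L`) with Plancherel.

* `torusFourier_comp_add` — the shift theorem; `torusFourier_sub'` — additivity;
* `torusChar_single_eq_exp`, `four_mul_abs_valMinAbs_div_le_norm_torusChar_single_sub_one` — `4|z̃_j|/L ≤ |χ_z(e_j) - 1|`;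
* (private) `sum_inv_one_add_valMinAbs_sq_le` — `Σ_{x ∈ ℤ/L} (1 + x̃²)⁻¹ ≤ 6`;
* **`sum_norm_torusFourier_le_of_differences`**.

Everything is proved; no definitions, no named facts.

## Sources

S. Friedli, Y. Velenik, *Statistical Mechanics of Lattice Systems*, CUP 2017, §10.4 (discrete Fourier analysis on the torus)
[`FriedliVelenik2017`]; the Bernstein embedding is classical (Katznelson, *Harmonic Analysis*, Ch. I §6).
-/

noncomputable section

namespace Literature.Probability.LatticeModels

open Finset Complex
open scoped ComplexConjugate Real

variable {L : ℕ} [NeZero L]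

/-! ### §1 Shift theorem and additivity -/

/-- **Shift theorem**: `(g(· + e))^(z) = χ_z(e)·ĝ(z)`. [cite: FriedliVelenik2017, §10.4] -/
theorem torusFourier_comp_add {d : ℕ} (g : TorusSite d L → ℂ) (e z : TorusSite d L) :
    torusFourier (fun x => g (x + e)) z = torusChar z e * torusFourier g z := by
  rw [torusFourier_eq_sum_torusChar, torusFourier_eq_sum_torusChar, mul_sum]
  have h : ∀ y : TorusSite d L, g y * conj (torusChar z (y - e)) = torusChar z e * (g y * conj (torusChar z y)) := by
    intro y
    rw [torusChar_sub_right, map_mul, Complex.conj_conj]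
    ring
  calc ∑ x : TorusSite d L, g (x + e) * conj (torusChar z x)
      = ∑ y : TorusSite d L, g y * conj (torusChar z (y - e)) :=
        Fintype.sum_equiv (Equiv.addRight e) _ _ fun x => by simp
    _ = _ := sum_congr rfl fun y _ => h y

/-- Additivity: `(f - g)^ = f̂ - ĝ`. [folklore] -/
private theorem torusFourier_sub' {d : ℕ} (f g : TorusSite d L → ℂ) (z : TorusSite d L) :
    torusFourier (fun x => f x - g x) z = torusFourier f z - torusFourier g z := by
  simp only [torusFourier_eq_sum_torusChar, sub_mul, sum_sub_distrib]

/-- The transform of a first difference: `(g(·+e) - g)^(z) = (χ_z(e) - 1)·ĝ(z)`. [cite: FriedliVelenik2017, §10.4] -/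
theorem torusFourier_diff {d : ℕ} (g : TorusSite d L → ℂ) (e z : TorusSite d L) :
    torusFourier (fun x => g (x + e) - g x) z = (torusChar z e - 1) * torusFourier g z := by
  rw [torusFourier_sub' (fun x => g (x + e)) g, torusFourier_comp_add, sub_mul, one_mul]

/-- The transform of the mixed second difference: `(g(·+e+e') - g(·+e) - g(·+e') + g)^(z) = (χ_z(e') - 1)(χ_z(e) - 1)·ĝ(z)`. [cite: FriedliVelenik2017, §10.4] -/
theorem torusFourier_diff_diff {d : ℕ} (g : TorusSite d L → ℂ) (e e' z : TorusSite d L) :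
    torusFourier (fun x => g (x + e + e') - g (x + e) - g (x + e') + g x) z =
      (torusChar z e' - 1) * (torusChar z e - 1) * torusFourier g z := by
  have h1 : (fun x => g (x + e + e') - g (x + e) - g (x + e') + g x) =
      fun x => (fun y => g (y + e) - g y) (x + e') - (fun y => g (y + e) - g y) x := by
    funext x
    simp only [add_right_comm x e' e]
    ring
  rw [h1, torusFourier_diff (fun y => g (y + e) - g y) e' z, torusFourier_diff g e z, mul_assoc]

/-! ### §2 The character of a unit step and the centred representative -/

/-- `χ_z(e_j) = exp(2πi z̃_j/L)` with `z̃_j = valMinAbs (z j)`. [cite: FriedliVelenik2017, §10.4] -/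
theorem torusChar_single_eq_exp {d : ℕ} (z : TorusSite d L) (j : Fin d) :
    torusChar z (Pi.single j 1) = Complex.exp (Complex.I * (2 * Real.pi * ((z j).valMinAbs : ℝ) / L : ℝ)) := by
  rw [torusChar]
  have h : ∀ i : Fin d, (ZMod.stdAddChar (z i * (Pi.single j (1 : ZMod L) : TorusSite d L) i) : ℂ) =
      if i = j then (ZMod.stdAddChar (z j) : ℂ) else 1 := by
    intro i
    by_cases hij : i = j
    · subst hij; simp
    · rw [if_neg hij, Pi.single_eq_of_ne hij, mul_zero, AddChar.map_zero_eq_one]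
  simp_rw [h]
  rw [prod_ite_eq' univ j, if_pos (mem_univ _)]
  have hz : z j = (((z j).valMinAbs : ℤ) : ZMod L) := (ZMod.coe_valMinAbs (z j)).symm
  rw [hz, ZMod.stdAddChar_coe, ← hz]
  congr 1
  push_cast
  ring

/-- **`4|z̃_j|/L ≤ |χ_z(e_j) - 1|`** (`|χ_z(e_j) - 1| = 2|sin(π z̃_j/L)|` and `|z̃_j| ≤ L/2`, `sin t ≥ 2t/π` on `[0, π/2]`). [cite: FriedliVelenik2017, §10.4] -/
theorem four_mul_abs_valMinAbs_div_le_norm_torusChar_single_sub_one {d : ℕ} (z : TorusSite d L) (j : Fin d) :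
    4 * |((z j).valMinAbs : ℝ)| / L ≤ ‖torusChar z (Pi.single j 1) - 1‖ := by
  have hL : (0 : ℝ) < L := Nat.cast_pos.2 (Nat.pos_of_ne_zero (NeZero.ne L))
  rw [torusChar_single_eq_exp, Complex.norm_exp_I_mul_ofReal_sub_one, Real.norm_eq_abs, abs_mul, abs_two]
  set m : ℝ := ((z j).valMinAbs : ℝ) with hm
  have hmL : |m| ≤ (L : ℝ) / 2 := by
    have h := ZMod.natAbs_valMinAbs_le (z j)
    have h' : (((z j).valMinAbs.natAbs : ℕ) : ℝ) ≤ ((L / 2 : ℕ) : ℝ) := by exact_mod_cast h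
    rw [hm, ← Int.cast_abs, Int.abs_eq_natAbs, Int.cast_natCast]
    exact h'.trans (Nat.cast_div_le.trans (by norm_num))
  -- `t = π m / L`, `|t| ≤ π/2`, `|sin t| ≥ (2/π)|t|`
  have ht : 2 * Real.pi * m / L / 2 = Real.pi * m / L := by ring
  rw [ht]
  have key : ∀ t : ℝ, |t| ≤ Real.pi / 2 → 2 / Real.pi * |t| ≤ |Real.sin t| := by
    intro t ht
    by_cases h0 : 0 ≤ t
    · rw [abs_of_nonneg h0] at ht ⊢
      exact (Real.mul_le_sin h0 ht).trans (le_abs_self _)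
    · have h0' : 0 ≤ -t := by linarith
      rw [abs_of_neg (lt_of_not_ge h0)] at ht ⊢
      calc 2 / Real.pi * -t ≤ Real.sin (-t) := Real.mul_le_sin h0' ht
        _ ≤ |Real.sin t| := by rw [Real.sin_neg]; exact neg_le_abs _
  have habs : |Real.pi * m / L| ≤ Real.pi / 2 := by
    rw [abs_div, abs_mul, abs_of_pos Real.pi_pos, abs_of_pos hL, div_le_div_iff₀ hL (by norm_num : (0 : ℝ) < 2)]
    nlinarith [Real.pi_pos]
  have h := key _ habs
  rw [abs_div, abs_mul, abs_of_pos Real.pi_pos, abs_of_pos hL] at h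
  calc 4 * |m| / L = 2 * (2 / Real.pi * (Real.pi * |m| / L)) := by field_simp; ring
    _ ≤ 2 * |Real.sin (Real.pi * m / L)| := by linarith

/-! ### §3 The one-dimensional weight sum `Σ (1 + x̃²)⁻¹ ≤ 6` -/

/-- Telescoping: `Σ_{n < N} 1/((n+1)(n+2)) ≤ 1`. [folklore] -/
private theorem sum_inv_succ_mul_le (N : ℕ) : ∑ n ∈ range N, (1 : ℝ) / (((n : ℝ) + 1) * ((n : ℝ) + 2)) ≤ 1 := by
  have h : ∀ N : ℕ, ∑ n ∈ range N, (1 : ℝ) / (((n : ℝ) + 1) * ((n : ℝ) + 2)) = 1 - 1 / ((N : ℝ) + 1) := by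
    intro N
    induction N with
    | zero => simp
    | succ N ih =>
      rw [sum_range_succ, ih]
      push_cast
      field_simp
      ring
  rw [h N]
  have : (0 : ℝ) < (N : ℝ) + 1 := by positivity
  have : 0 ≤ 1 / ((N : ℝ) + 1) := by positivity
  linarith

/-- `Σ_{n ≤ N} (1 + n²)⁻¹ ≤ 3` (`(1+n²)⁻¹ ≤ 2/((n+1)(n+2))` for `n ≥ 1`... in fact for all `n`: `(n+1)(n+2) ≤ 2(1+n²) + 3n`; we use
`(1 + n²)⁻¹ ≤ 2/(n(n+1))` for `n ≥ 1` in the shifted form). [folklore] -/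
private theorem sum_inv_one_add_sq_nat_le (N : ℕ) : ∑ n ∈ range (N + 1), (1 : ℝ) / (1 + (n : ℝ) ^ 2) ≤ 3 := by
  rw [sum_range_succ']
  push_cast
  have h1 : ∀ n ∈ range N, (1 : ℝ) / (1 + ((n : ℝ) + 1) ^ 2) ≤ 2 * (1 / (((n : ℝ) + 1) * ((n : ℝ) + 2))) := by
    intro n _
    rw [div_le_iff₀ (by positivity), show 2 * (1 / (((n : ℝ) + 1) * ((n : ℝ) + 2))) * (1 + ((n : ℝ) + 1) ^ 2) =
      2 * (1 + ((n : ℝ) + 1) ^ 2) / (((n : ℝ) + 1) * ((n : ℝ) + 2)) by ring, le_div_iff₀ (by positivity)]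
    nlinarith [sq_nonneg (n : ℝ), Nat.cast_nonneg (α := ℝ) n]
  have h2 := sum_le_sum h1
  rw [← mul_sum] at h2
  have h3 := sum_inv_succ_mul_le N
  simp only [zero_pow two_ne_zero, add_zero, div_one] at *
  linarith

/-- **`Σ_{x ∈ ℤ/Lℤ} (1 + x̃²)⁻¹ ≤ 6`** (`x̃ = valMinAbs x`; the map `x ↦ |x̃|` is at most two-to-one into `ℕ`). [folklore] -/
private theorem sum_inv_one_add_valMinAbs_sq_le : ∑ x : ZMod L, (1 : ℝ) / (1 + ((x.valMinAbs : ℝ)) ^ 2) ≤ 6 := by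
  have hval : ∀ x : ZMod L, (1 : ℝ) / (1 + ((x.valMinAbs : ℝ)) ^ 2) = (1 : ℝ) / (1 + ((x.valMinAbs.natAbs : ℕ) : ℝ) ^ 2) := by
    intro x
    rw [← Int.cast_natCast (R := ℝ) x.valMinAbs.natAbs, Int.natCast_natAbs, Int.cast_abs, sq_abs]
  -- fibres of `x ↦ |x̃|` have at most two elements
  have hc1 : ∀ m : ℤ, ((univ : Finset (ZMod L)).filter fun x => x.valMinAbs = m).card ≤ 1 := by
    intro m
    refine card_le_one.2 fun x hx y hy => ?_
    rw [mem_filter] at hx hy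
    exact ZMod.injective_valMinAbs (hx.2.trans hy.2.symm)
  have hfib : ∀ n : ℕ, ((univ : Finset (ZMod L)).filter fun x => x.valMinAbs.natAbs = n).card ≤ 2 := by
    intro n
    have hsub : ((univ : Finset (ZMod L)).filter fun x => x.valMinAbs.natAbs = n) ⊆
        ((univ : Finset (ZMod L)).filter fun x => x.valMinAbs = (n : ℤ)) ∪
          ((univ : Finset (ZMod L)).filter fun x => x.valMinAbs = -(n : ℤ)) := by
      intro x hx
      rw [mem_filter] at hx
      rw [mem_union, mem_filter, mem_filter]
      have h := Int.natAbs_eq x.valMinAbs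
      rw [hx.2] at h
      rcases h with h' | h'
      · exact Or.inl ⟨mem_univ _, h'⟩
      · exact Or.inr ⟨mem_univ _, h'⟩
    exact (card_le_card hsub).trans ((card_union_le _ _).trans (add_le_add (hc1 _) (hc1 _)))
  -- regroup by fibres
  have hN : ∀ x ∈ (univ : Finset (ZMod L)), x.valMinAbs.natAbs ∈ range (L + 1) := by
    intro x _
    rw [mem_range]
    have := ZMod.natAbs_valMinAbs_le x
    omega
  rw [sum_congr rfl fun x _ => hval x, ← sum_fiberwise_of_maps_to hN]
  have hinner : ∀ n ∈ range (L + 1),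
      ∑ x ∈ univ.filter (fun x : ZMod L => x.valMinAbs.natAbs = n), (1 : ℝ) / (1 + ((x.valMinAbs.natAbs : ℕ) : ℝ) ^ 2) ≤
        2 * (1 / (1 + (n : ℝ) ^ 2)) := by
    intro n _
    rw [sum_congr rfl fun x hx => by rw [(mem_filter.1 hx).2], sum_const, nsmul_eq_mul]
    refine mul_le_mul_of_nonneg_right ?_ (by positivity)
    exact_mod_cast hfib n
  calc _ ≤ ∑ n ∈ range (L + 1), 2 * (1 / (1 + (n : ℝ) ^ 2)) := sum_le_sum hinner
    _ = 2 * ∑ n ∈ range (L + 1), 1 / (1 + (n : ℝ) ^ 2) := by rw [mul_sum]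
    _ ≤ 2 * 3 := by linarith [sum_inv_one_add_sq_nat_le L]
    _ = 6 := by norm_num

/-! ### §4 The `ℓ¹` bound -/

/-- Plancherel with a uniform bound: `Σ_z ‖f̂(z)‖² ≤ L²·L²·B²` if `‖f‖ ≤ B` on `(ℤ/L)²`. [cite: FriedliVelenik2017, §10.4] -/
theorem sum_norm_sq_torusFourier_le (f : TorusSite 2 L → ℂ) {B : ℝ} (hB : ∀ x, ‖f x‖ ≤ B) :
    ∑ z : TorusSite 2 L, ‖torusFourier f z‖ ^ 2 ≤ (L : ℝ) ^ 2 * ((L : ℝ) ^ 2 * B ^ 2) := by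
  rw [torusFourier_plancherel_holds (d := 2) (L := L) f]
  refine mul_le_mul_of_nonneg_left ?_ (by positivity)
  calc ∑ x : TorusSite 2 L, ‖f x‖ ^ 2 ≤ ∑ _x : TorusSite 2 L, B ^ 2 :=
        sum_le_sum fun x _ => pow_le_pow_left₀ (norm_nonneg _) (hB x) 2
    _ = (L : ℝ) ^ 2 * B ^ 2 := by
        rw [sum_const, card_univ, nsmul_eq_mul]
        congr 1
        rw [Fintype.card_pi, Fin.prod_const, ZMod.card]
        push_cast
        ring

/-- **Wiener-type `ℓ¹` bound on `(ℤ/Lℤ)²`**: if `‖g‖ ≤ S₀`, `‖g(·+e_j) - g‖ ≤ D₁` (`j = 0, 1`) and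
`‖g(·+e₀+e₁) - g(·+e₀) - g(·+e₁) + g‖ ≤ D₂`, then `L⁻² Σ_z ‖ĝ(z)‖ ≤ 6·√(S₀² + L²D₁²/8 + L⁴D₂²/256)`. [cite: FriedliVelenik2017, §10.4] -/
theorem sum_norm_torusFourier_le_of_differences (g : TorusSite 2 L → ℂ) {S₀ D₁ D₂ : ℝ}
    (h0 : ∀ x, ‖g x‖ ≤ S₀) (h1 : ∀ (j : Fin 2) (x : TorusSite 2 L), ‖g (x + Pi.single j 1) - g x‖ ≤ D₁)
    (h2 : ∀ x : TorusSite 2 L,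
      ‖g (x + Pi.single 0 1 + Pi.single 1 1) - g (x + Pi.single 0 1) - g (x + Pi.single 1 1) + g x‖ ≤ D₂) :
    ((L : ℝ) ^ 2)⁻¹ * ∑ z : TorusSite 2 L, ‖torusFourier g z‖ ≤
      6 * Real.sqrt (S₀ ^ 2 + (L : ℝ) ^ 2 / 8 * D₁ ^ 2 + (L : ℝ) ^ 4 / 256 * D₂ ^ 2) := by
  have hL : (0 : ℝ) < L := Nat.cast_pos.2 (Nat.pos_of_ne_zero (NeZero.ne L))
  -- the weight
  set m : TorusSite 2 L → Fin 2 → ℝ := fun z j => (((z j).valMinAbs : ℤ) : ℝ) with hm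
  set W : TorusSite 2 L → ℝ := fun z => (1 + m z 0 ^ 2) * (1 + m z 1 ^ 2) with hW
  have hWpos : ∀ z, 0 < W z := fun z => by rw [hW]; positivity
  -- (1) `Σ 1/W ≤ 36`
  have h1D := sum_inv_one_add_valMinAbs_sq_le (L := L)
  have h1D0 : 0 ≤ ∑ x : ZMod L, (1 : ℝ) / (1 + ((x.valMinAbs : ℝ)) ^ 2) := sum_nonneg fun x _ => by positivity
  have hWsum : ∑ z : TorusSite 2 L, 1 / W z ≤ 36 := by
    have hprod : ∑ z : TorusSite 2 L, 1 / W z =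
        ∏ j : Fin 2, ∑ x : ZMod L, (1 : ℝ) / (1 + ((x.valMinAbs : ℝ)) ^ 2) := by
      rw [Finset.prod_univ_sum]
      simp only [Fintype.piFinset_univ]
      refine sum_congr rfl fun z _ => ?_
      rw [Fin.prod_univ_two, hW, hm]
      dsimp only
      rw [one_div_mul_one_div]
    rw [hprod, Fin.prod_univ_two]
    nlinarith
  -- (2) the pointwise weighted bound
  set e0 : TorusSite 2 L := Pi.single 0 1 with he0
  set e1 : TorusSite 2 L := Pi.single 1 1 with he1
  set g0 : TorusSite 2 L → ℂ := fun x => g (x + e0) - g x with hg0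
  set g1 : TorusSite 2 L → ℂ := fun x => g (x + e1) - g x with hg1
  set g01 : TorusSite 2 L → ℂ := fun x => g (x + e0 + e1) - g (x + e0) - g (x + e1) + g x with hg01
  have hF0 : ∀ z, torusFourier g0 z = (torusChar z e0 - 1) * torusFourier g z := fun z => torusFourier_diff g e0 z
  have hF1 : ∀ z, torusFourier g1 z = (torusChar z e1 - 1) * torusFourier g z := fun z => torusFourier_diff g e1 z
  have hF01 : ∀ z, torusFourier g01 z = (torusChar z e1 - 1) * (torusChar z e0 - 1) * torusFourier g z :=
    fun z => torusFourier_diff_diff g e0 e1 z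
  have hmj : ∀ z (j : Fin 2), m z j ^ 2 ≤ (L : ℝ) ^ 2 / 16 * ‖torusChar z (Pi.single j 1) - 1‖ ^ 2 := by
    intro z j
    have h := four_mul_abs_valMinAbs_div_le_norm_torusChar_single_sub_one z j
    have h' : 4 * |m z j| ≤ (L : ℝ) * ‖torusChar z (Pi.single j 1) - 1‖ := by
      rw [hm]; dsimp only
      rw [div_le_iff₀ hL] at h
      linarith
    have h'' := pow_le_pow_left₀ (by positivity) h' 2
    rw [mul_pow, mul_pow, sq_abs] at h''
    nlinarith
  have hpt : ∀ z, W z * ‖torusFourier g z‖ ^ 2 ≤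
      ‖torusFourier g z‖ ^ 2 + (L : ℝ) ^ 2 / 16 * (‖torusFourier g0 z‖ ^ 2 + ‖torusFourier g1 z‖ ^ 2) +
        (L : ℝ) ^ 4 / 256 * ‖torusFourier g01 z‖ ^ 2 := by
    intro z
    rw [hF0, hF1, hF01, norm_mul, norm_mul, norm_mul, mul_pow, mul_pow, mul_pow, norm_mul, mul_pow]
    have hm0 := hmj z 0
    have hm1 := hmj z 1
    rw [← he0] at hm0
    rw [← he1] at hm1
    set A := ‖torusFourier g z‖ ^ 2
    set a0 := ‖torusChar z e0 - 1‖ ^ 2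
    set a1 := ‖torusChar z e1 - 1‖ ^ 2
    have hA : 0 ≤ A := by positivity
    have ha0 : 0 ≤ a0 := by positivity
    have ha1 : 0 ≤ a1 := by positivity
    have hm00 : 0 ≤ m z 0 ^ 2 := sq_nonneg _
    have hm11 : 0 ≤ m z 1 ^ 2 := sq_nonneg _
    rw [hW]
    dsimp only
    have hprod : m z 0 ^ 2 * m z 1 ^ 2 ≤ ((L : ℝ) ^ 2 / 16 * a0) * ((L : ℝ) ^ 2 / 16 * a1) :=
      mul_le_mul hm0 hm1 hm11 (by positivity)
    nlinarith [mul_le_mul_of_nonneg_right hm0 hA, mul_le_mul_of_nonneg_right hm1 hA, mul_le_mul_of_nonneg_right hprod hA]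
  -- (3) sum + Plancherel
  have hS0' : ∑ z : TorusSite 2 L, ‖torusFourier g z‖ ^ 2 ≤ (L : ℝ) ^ 2 * ((L : ℝ) ^ 2 * S₀ ^ 2) :=
    sum_norm_sq_torusFourier_le g h0
  have hD0' : ∑ z : TorusSite 2 L, ‖torusFourier g0 z‖ ^ 2 ≤ (L : ℝ) ^ 2 * ((L : ℝ) ^ 2 * D₁ ^ 2) :=
    sum_norm_sq_torusFourier_le g0 fun x => h1 0 x
  have hD1' : ∑ z : TorusSite 2 L, ‖torusFourier g1 z‖ ^ 2 ≤ (L : ℝ) ^ 2 * ((L : ℝ) ^ 2 * D₁ ^ 2) :=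
    sum_norm_sq_torusFourier_le g1 fun x => h1 1 x
  have hD01' : ∑ z : TorusSite 2 L, ‖torusFourier g01 z‖ ^ 2 ≤ (L : ℝ) ^ 2 * ((L : ℝ) ^ 2 * D₂ ^ 2) :=
    sum_norm_sq_torusFourier_le g01 h2
  have hWg : ∑ z : TorusSite 2 L, W z * ‖torusFourier g z‖ ^ 2 ≤
      (L : ℝ) ^ 4 * (S₀ ^ 2 + (L : ℝ) ^ 2 / 8 * D₁ ^ 2 + (L : ℝ) ^ 4 / 256 * D₂ ^ 2) := by
    calc ∑ z : TorusSite 2 L, W z * ‖torusFourier g z‖ ^ 2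
        ≤ ∑ z : TorusSite 2 L, (‖torusFourier g z‖ ^ 2 + (L : ℝ) ^ 2 / 16 * (‖torusFourier g0 z‖ ^ 2 + ‖torusFourier g1 z‖ ^ 2) +
            (L : ℝ) ^ 4 / 256 * ‖torusFourier g01 z‖ ^ 2) := sum_le_sum fun z _ => hpt z
      _ = ∑ z : TorusSite 2 L, ‖torusFourier g z‖ ^ 2 +
            (L : ℝ) ^ 2 / 16 * (∑ z : TorusSite 2 L, ‖torusFourier g0 z‖ ^ 2 + ∑ z : TorusSite 2 L, ‖torusFourier g1 z‖ ^ 2) +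
            (L : ℝ) ^ 4 / 256 * ∑ z : TorusSite 2 L, ‖torusFourier g01 z‖ ^ 2 := by
          rw [sum_add_distrib, sum_add_distrib, ← mul_sum, ← mul_sum, sum_add_distrib]
      _ ≤ (L : ℝ) ^ 2 * ((L : ℝ) ^ 2 * S₀ ^ 2) +
            (L : ℝ) ^ 2 / 16 * ((L : ℝ) ^ 2 * ((L : ℝ) ^ 2 * D₁ ^ 2) + (L : ℝ) ^ 2 * ((L : ℝ) ^ 2 * D₁ ^ 2)) +
            (L : ℝ) ^ 4 / 256 * ((L : ℝ) ^ 2 * ((L : ℝ) ^ 2 * D₂ ^ 2)) := by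
          gcongr
      _ = _ := by ring
  -- (4) Cauchy–Schwarz
  have hCS := sum_sq_le_sum_mul_sum_of_sq_le_mul (univ : Finset (TorusSite 2 L))
    (f := fun z => 1 / W z) (g := fun z => W z * ‖torusFourier g z‖ ^ 2) (r := fun z => ‖torusFourier g z‖)
    (fun z _ => by positivity) (fun z _ => by positivity)
    (fun z _ => by rw [one_div, ← mul_assoc, inv_mul_cancel₀ (hWpos z).ne', one_mul])
  have hX0 : 0 ≤ S₀ ^ 2 + (L : ℝ) ^ 2 / 8 * D₁ ^ 2 + (L : ℝ) ^ 4 / 256 * D₂ ^ 2 := by positivity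
  have hsum0 : 0 ≤ ∑ z : TorusSite 2 L, ‖torusFourier g z‖ := sum_nonneg fun z _ => norm_nonneg _
  have hsq : (∑ z : TorusSite 2 L, ‖torusFourier g z‖) ^ 2 ≤
      (6 * (L : ℝ) ^ 2 * Real.sqrt (S₀ ^ 2 + (L : ℝ) ^ 2 / 8 * D₁ ^ 2 + (L : ℝ) ^ 4 / 256 * D₂ ^ 2)) ^ 2 := by
    rw [mul_pow, mul_pow, Real.sq_sqrt hX0]
    calc (∑ z : TorusSite 2 L, ‖torusFourier g z‖) ^ 2
        ≤ (∑ z : TorusSite 2 L, 1 / W z) * ∑ z : TorusSite 2 L, W z * ‖torusFourier g z‖ ^ 2 := hCS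
      _ ≤ 36 * ((L : ℝ) ^ 4 * (S₀ ^ 2 + (L : ℝ) ^ 2 / 8 * D₁ ^ 2 + (L : ℝ) ^ 4 / 256 * D₂ ^ 2)) :=
          mul_le_mul hWsum hWg (sum_nonneg fun z _ => by positivity) (by norm_num)
      _ = _ := by ring
  have hB0 : 0 ≤ 6 * (L : ℝ) ^ 2 * Real.sqrt (S₀ ^ 2 + (L : ℝ) ^ 2 / 8 * D₁ ^ 2 + (L : ℝ) ^ 4 / 256 * D₂ ^ 2) := by
    positivity
  have hle : ∑ z : TorusSite 2 L, ‖torusFourier g z‖ ≤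
      6 * (L : ℝ) ^ 2 * Real.sqrt (S₀ ^ 2 + (L : ℝ) ^ 2 / 8 * D₁ ^ 2 + (L : ℝ) ^ 4 / 256 * D₂ ^ 2) :=
    (pow_le_pow_iff_left₀ hsum0 hB0 two_ne_zero).1 hsq
  have hL2 : (0 : ℝ) < (L : ℝ) ^ 2 := by positivity
  calc ((L : ℝ) ^ 2)⁻¹ * ∑ z : TorusSite 2 L, ‖torusFourier g z‖
      ≤ ((L : ℝ) ^ 2)⁻¹ * (6 * (L : ℝ) ^ 2 * Real.sqrt (S₀ ^ 2 + (L : ℝ) ^ 2 / 8 * D₁ ^ 2 + (L : ℝ) ^ 4 / 256 * D₂ ^ 2)) :=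
        mul_le_mul_of_nonneg_left hle (by positivity)
    _ = 6 * Real.sqrt (S₀ ^ 2 + (L : ℝ) ^ 2 / 8 * D₁ ^ 2 + (L : ℝ) ^ 4 / 256 * D₂ ^ 2) := by
        field_simp

end Literature.Probability.LatticeModels

end
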